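import Summits.NavierStokesRegularity.FunctionalMining.NoGo.DirectorForm
import HarnessLib

/-!
# FunctionalMining — the top eigenvalue of `tK + E` near the double top of `K`: Weyl window, the
# Schur / secular characterisation and the `R*` remainder (F1 PART I, Lemma 10 (a), (c) for `λ₁`)

Search for candidate a priori estimates; no regularity claim. Cell `pub-nsfunc`, prove seat
(gen 22). Kernel form of the analytic half of the no-go seat's F1 PART I LEMMA 10 for the TOP
eigenvalue (pen, countersigned in the cell — not a cited fact; the algebraic step (b) is
`StrainBlockReduction.lean`). In the frame `ℝ³ = n^⊥ ⊕ ℝn`, `K = m(𝟙 − 3n⊗n)`,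
`E = [[B, b], [bᵀ, e_nn]]`, the matrix `S = tK + E` is given through its RAYLEIGH FORM

  `fᵀ S f = tm (f₀² + f₁² − 2f₂²) + (B₀₀f₀² + 2B₀₁f₀f₁ + B₁₁f₁²) + 2f₂(b₀f₀ + b₁f₁) + e_nn f₂²`,

and for a level `λ` with `D(λ) := λ + 2tm − e_nn > 0` the reduced `2 × 2` matrix `M(λ) = B + b⊗b/D(λ)`
through `wᵀ M(λ) w = B₀₀w₀² + 2B₀₁w₀w₁ + B₁₁w₁² + (b₀w₀ + b₁w₁)²/D(λ)`; `λ₁(·)` is the top Rayleigh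
value `SharpClass.DirectorForm.lam1` (`= TopEig.lam ∘ flat`).

* **`BlockReduction.lam1_le_iff_reduced`** (SCHUR / SECULAR CHARACTERISATION): for `D(λ) > 0`,
  `λ₁(S) ≤ λ ↔ λ₁(M(λ)) ≤ λ − tm` (complete the square in the `n`-component);
* **`BlockReduction.lam1_reduced_eq`** (the "monotonicity / fixed-point sentence" of the pen proof,
  in closed form): if `D(λ₁(S)) > 0` then `λ₁(M(λ₁(S))) = λ₁(S) − tm` — the top eigenvalue solves the
  reduced problem at its own level;
* `BlockReduction.lam1_window` (Lemma 10 (a) for `λ₁`): `tm − ε ≤ λ₁(S) ≤ tm + ε` when the `E`-form is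
  `≤ ε|f|²` and `B₀₀ ≥ −ε` (`tm ≥ 0`); `BlockReduction.reduced_level_pos`: then `D(λ₁(S)) ≥ 3tm − 2ε`;
* `BlockReduction.abs_lam1_reduced_sub_le`: `|λ₁(M(λ)) − λ₁(M̄)| ≤ |b|²·|1/D(λ) − 1/(3tm)|` for the
  frozen matrix `M̄ = B + b⊗b/(3tm)`; `BlockReduction.abs_inv_sub_inv_le`: the window gives
  `|1/D(λ₁) − 1/(3tm)| ≤ 2ε/(3tm(3tm − 2ε))`;
* **`BlockReduction.abs_lam1_sub_reduced_le`** (LEMMA 10 (c) for `λ₁`):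
  `|λ₁(S) − tm − λ₁(M̄)| ≤ |b|² · 2ε/(3tm(3tm − 2ε)) ≤ R* := 2ε³/(3tm(3tm − 2ε))`.

The hypotheses on `E` are stated as the separate consequences of `|E| ≤ ε` that are used
(`E`-form `≤ ε|f|²`, `B₀₀ ≥ −ε`, `|e_nn| ≤ ε`, `|b|² ≤ ε²`). The statements for `λ₂` (bottom of the
reduced problem) and the eigenvector part (d) are not in this file. Elementary: Rayleigh bounds,
attainment of `λ₁` on the unit sphere, completing a square. [ours; folklore]
-/

noncomputable section

open Matrix

namespace Summit.NavierStokesRegularity.FunctionalMining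

open SharpClass.DirectorForm

namespace BlockReduction

/-! ## 0. Rayleigh tools -/

/-- Rayleigh bound for an arbitrary vector: `fᵀ M f ≤ λ₁(M) |f|²`. [folklore] -/
theorem ray_le_lam1_mul {d : Type*} [Fintype d] (M : Matrix d d ℝ) (f : d → ℝ) :
    f ⬝ᵥ M *ᵥ f ≤ lam1 M * (f ⬝ᵥ f) := by
  have h := TopEig.quad_le_lam_mul (flat M) f
  rw [quad_flat] at h
  exact h

/-! ## 1. The Schur / secular characterisation of the top eigenvalue -/

variable {S : Matrix (Fin 3) (Fin 3) ℝ} {t m B00 B01 B11 b0 b1 enn : ℝ}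

/-- **SCHUR / SECULAR CHARACTERISATION (F1 PART I Lemma 10, the content of the "monotonicity"
sentence in (c)).** Let `S = tK + E` be given by its Rayleigh form in the frame `(n^⊥, n)` and let
`M` have the Rayleigh form of the reduced matrix `B + b⊗b/D(λ)` at a level `λ` with
`D(λ) = λ + 2tm − e_nn > 0`. Then `λ₁(S) ≤ λ ↔ λ₁(M) ≤ λ − tm`. (Complete the square in the
`n`-component: `2sβ − Ds² = β²/D − D(s − β/D)²`.) [ours; folklore — Schur complement] -/
theorem lam1_le_iff_reduced
    (hS : ∀ f : Fin 3 → ℝ, f ⬝ᵥ S *ᵥ f = t * m * (f 0 ^ 2 + f 1 ^ 2 - 2 * f 2 ^ 2) +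
      (B00 * f 0 ^ 2 + 2 * B01 * f 0 * f 1 + B11 * f 1 ^ 2) + 2 * f 2 * (b0 * f 0 + b1 * f 1) + enn * f 2 ^ 2)
    {lam0 : ℝ} (hD : 0 < lam0 + 2 * (t * m) - enn) {M : Matrix (Fin 2) (Fin 2) ℝ}
    (hM : ∀ w : Fin 2 → ℝ, w ⬝ᵥ M *ᵥ w = B00 * w 0 ^ 2 + 2 * B01 * w 0 * w 1 + B11 * w 1 ^ 2 +
      (b0 * w 0 + b1 * w 1) ^ 2 / (lam0 + 2 * (t * m) - enn)) :
    lam1 S ≤ lam0 ↔ lam1 M ≤ lam0 - t * m := by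
  set D := lam0 + 2 * (t * m) - enn with hDdef
  constructor
  · intro hle
    refine lam1_le fun w hw => ?_
    simp only [dotProduct, Fin.sum_univ_two, ← pow_two] at hw
    -- test `S` with `f = (w₀, w₁, β/D)`
    set β := b0 * w 0 + b1 * w 1 with hβ
    set f : Fin 3 → ℝ := ![w 0, w 1, β / D] with hf
    have h1 := ray_le_lam1_mul S f
    have hff : f ⬝ᵥ f = w 0 ^ 2 + w 1 ^ 2 + (β / D) ^ 2 := by
      simp only [hf, dotProduct, Fin.sum_univ_three, Matrix.cons_val_zero, Matrix.cons_val_one,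
        Matrix.cons_val_two, Matrix.head_cons, Matrix.tail_cons]
      ring
    have hSf := hS f
    simp only [hf, Matrix.cons_val_zero, Matrix.cons_val_one, Matrix.head_cons, Matrix.cons_val_two,
      Matrix.tail_cons] at hSf
    have h2 : lam1 S * (f ⬝ᵥ f) ≤ lam0 * (f ⬝ᵥ f) :=
      mul_le_mul_of_nonneg_right hle (by rw [hff]; positivity)
    rw [hM w]
    have hkey : B00 * w 0 ^ 2 + 2 * B01 * w 0 * w 1 + B11 * w 1 ^ 2 + β ^ 2 / D ≤
        (lam0 - t * m) * (w 0 ^ 2 + w 1 ^ 2) := by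
      have h3 := h1.trans h2
      rw [hSf, hff] at h3
      have hβD : 2 * (β / D) * β + enn * (β / D) ^ 2 - 2 * (t * m) * (β / D) ^ 2 -
          lam0 * (β / D) ^ 2 = β ^ 2 / D := by
        field_simp
        ring
      nlinarith [hβD, h3]
    rw [hw, mul_one] at hkey
    exact hkey
  · intro hle
    refine lam1_le fun f hf => ?_
    rw [hS f]
    simp only [dotProduct, Fin.sum_univ_three, ← pow_two] at hf
    set w : Fin 2 → ℝ := ![f 0, f 1] with hw
    have hMw := ray_le_lam1_mul M w
    rw [hM w] at hMw
    simp only [hw, dotProduct, Fin.sum_univ_two, ← pow_two, Matrix.cons_val_zero, Matrix.cons_val_one] at hMw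
    -- `wᵀBw + β²/D ≤ λ₁(M)|w|² ≤ (λ − tm)|w|²`
    have h1 : lam1 M * (f 0 ^ 2 + f 1 ^ 2) ≤ (lam0 - t * m) * (f 0 ^ 2 + f 1 ^ 2) :=
      mul_le_mul_of_nonneg_right hle (by positivity)
    -- complete the square: `2sβ − D s² ≤ β²/D`
    have h2 : 2 * f 2 * (b0 * f 0 + b1 * f 1) - D * f 2 ^ 2 ≤ (b0 * f 0 + b1 * f 1) ^ 2 / D := by
      rw [div_eq_mul_inv]
      have hDi : 0 < D⁻¹ := inv_pos.2 hD
      nlinarith [mul_self_nonneg ((b0 * f 0 + b1 * f 1) * D⁻¹ - f 2), mul_inv_cancel₀ hD.ne', hDi]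
    have hD2 : D * f 2 ^ 2 = (lam0 + 2 * (t * m) - enn) * f 2 ^ 2 := by rw [hDdef]
    have hf' : lam0 * (f 0 ^ 2 + f 1 ^ 2 + f 2 ^ 2) = lam0 := by rw [hf, mul_one]
    nlinarith [hMw, h1, h2, hf, hD2, hf']

/-- **THE TOP EIGENVALUE SOLVES THE REDUCED PROBLEM AT ITS OWN LEVEL (F1 PART I Lemma 10 (c), the
fixed-point sentence).** With `S` as above, if `D(λ₁(S)) = λ₁(S) + 2tm − e_nn > 0` and `M` has the
Rayleigh form of `B + b⊗b/D(λ₁(S))`, then `λ₁(M) = λ₁(S) − tm`. (`≤` is the Schur direction; for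
`≥` test `M` with the `n^⊥`-part `w` of a top vector `(w, s)` of `S` — `w ≠ 0` since `w = 0` would give
`λ₁(S) = e_nn − 2tm`, i.e. `D = 0`.) [ours; folklore] -/
theorem lam1_reduced_eq
    (hS : ∀ f : Fin 3 → ℝ, f ⬝ᵥ S *ᵥ f = t * m * (f 0 ^ 2 + f 1 ^ 2 - 2 * f 2 ^ 2) +
      (B00 * f 0 ^ 2 + 2 * B01 * f 0 * f 1 + B11 * f 1 ^ 2) + 2 * f 2 * (b0 * f 0 + b1 * f 1) + enn * f 2 ^ 2)
    (hD : 0 < lam1 S + 2 * (t * m) - enn) {M : Matrix (Fin 2) (Fin 2) ℝ}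
    (hM : ∀ w : Fin 2 → ℝ, w ⬝ᵥ M *ᵥ w = B00 * w 0 ^ 2 + 2 * B01 * w 0 * w 1 + B11 * w 1 ^ 2 +
      (b0 * w 0 + b1 * w 1) ^ 2 / (lam1 S + 2 * (t * m) - enn)) :
    lam1 M = lam1 S - t * m := by
  refine le_antisymm ((lam1_le_iff_reduced hS hD hM).1 le_rfl) ?_
  set D := lam1 S + 2 * (t * m) - enn with hDdef
  obtain ⟨f, hf, hfS⟩ := exists_ray_eq_lam1 S
  rw [hS f] at hfS
  simp only [dotProduct, Fin.sum_univ_three, ← pow_two] at hf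
  -- complete the square: `2sβ − D s² ≤ β²/D`
  have h2 : 2 * f 2 * (b0 * f 0 + b1 * f 1) - D * f 2 ^ 2 ≤ (b0 * f 0 + b1 * f 1) ^ 2 / D := by
    rw [div_eq_mul_inv]
    have hDi : 0 < D⁻¹ := inv_pos.2 hD
    nlinarith [mul_self_nonneg ((b0 * f 0 + b1 * f 1) * D⁻¹ - f 2), mul_inv_cancel₀ hD.ne', hDi]
  -- `(λ₁ − tm)|w|² ≤ wᵀ M w`
  set w : Fin 2 → ℝ := ![f 0, f 1] with hw
  have hMw : w ⬝ᵥ M *ᵥ w =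
      B00 * f 0 ^ 2 + 2 * B01 * f 0 * f 1 + B11 * f 1 ^ 2 + (b0 * f 0 + b1 * f 1) ^ 2 / D := by
    rw [hM w]
    simp [hw]
  have hww : w ⬝ᵥ w = f 0 ^ 2 + f 1 ^ 2 := by
    simp only [hw, dotProduct, Fin.sum_univ_two, Matrix.cons_val_zero, Matrix.cons_val_one]
    ring
  have hD2 : D * f 2 ^ 2 = (lam1 S + 2 * (t * m) - enn) * f 2 ^ 2 := by rw [hDdef]
  have hf' : lam1 S * (f 0 ^ 2 + f 1 ^ 2 + f 2 ^ 2) = lam1 S := by rw [hf, mul_one]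
  have hkey : (lam1 S - t * m) * (f 0 ^ 2 + f 1 ^ 2) ≤ w ⬝ᵥ M *ᵥ w := by
    rw [hMw]
    nlinarith [h2, hfS, hf, hD2, hf']
  -- `w ≠ 0`: otherwise `f = ±n` is a top vector, `λ₁(S) = e_nn − 2tm`, `D = 0`
  have hwpos : 0 < f 0 ^ 2 + f 1 ^ 2 := by
    rcases (show 0 ≤ f 0 ^ 2 + f 1 ^ 2 by positivity).eq_or_lt with h | h
    · exfalso
      have h0 : f 0 = 0 := by nlinarith [sq_nonneg (f 0), sq_nonneg (f 1)]
      have h1 : f 1 = 0 := by nlinarith [sq_nonneg (f 0), sq_nonneg (f 1)]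
      have h22 : f 2 ^ 2 = 1 := by rw [h0, h1] at hf; linarith
      rw [h0, h1, h22] at hfS
      have hval : lam1 S = -2 * (t * m) + enn := by linarith [hfS]
      have hD0 : D = 0 := by rw [hDdef, hval]; ring
      linarith [hD, hD0]
    · exact h
  -- normalise
  have hray := ray_le_lam1_mul M w
  rw [hww] at hray
  nlinarith [hkey, hray, hwpos]

/-! ## 2. Lemma 10 (a): the Weyl window for `λ₁`, and positivity of the reduced level -/

/-- **WEYL WINDOW for `λ₁` (F1 PART I Lemma 10 (a)).** If `tm ≥ 0`, the `E`-form is `≤ ε|f|²` and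
`B₀₀ ≥ −ε` (both consequences of `|E| ≤ ε`), then `tm − ε ≤ λ₁(S) ≤ tm + ε`. [folklore; Weyl] -/
theorem lam1_window
    (hS : ∀ f : Fin 3 → ℝ, f ⬝ᵥ S *ᵥ f = t * m * (f 0 ^ 2 + f 1 ^ 2 - 2 * f 2 ^ 2) +
      (B00 * f 0 ^ 2 + 2 * B01 * f 0 * f 1 + B11 * f 1 ^ 2) + 2 * f 2 * (b0 * f 0 + b1 * f 1) + enn * f 2 ^ 2)
    (htm : 0 ≤ t * m) {ε : ℝ}
    (hE : ∀ f : Fin 3 → ℝ, (B00 * f 0 ^ 2 + 2 * B01 * f 0 * f 1 + B11 * f 1 ^ 2) +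
      2 * f 2 * (b0 * f 0 + b1 * f 1) + enn * f 2 ^ 2 ≤ ε * (f 0 ^ 2 + f 1 ^ 2 + f 2 ^ 2))
    (hB00 : -ε ≤ B00) :
    t * m - ε ≤ lam1 S ∧ lam1 S ≤ t * m + ε := by
  constructor
  · -- test with `f = e₀`
    have h := ray_le_lam1 S (e := ![1, 0, 0]) (by simp [dotProduct, Fin.sum_univ_three])
    rw [hS] at h
    simp at h
    linarith
  · refine lam1_le fun f hf => ?_
    rw [hS f]
    simp only [dotProduct, Fin.sum_univ_three, ← pow_two] at hf
    have h1 := hE f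
    rw [hf, mul_one] at h1
    nlinarith [h1, hf, sq_nonneg (f 2), htm]

/-- **The reduced level is positive**: under the window and `e_nn ≤ ε`, `2ε < 3tm`:
`D(λ₁(S)) = λ₁(S) + 2tm − e_nn ≥ 3tm − 2ε > 0`. [folklore] -/
theorem reduced_level_pos {ε : ℝ} (hwin : t * m - ε ≤ lam1 S) (henn : enn ≤ ε) (hε : 2 * ε < 3 * (t * m)) :
    3 * (t * m) - 2 * ε ≤ lam1 S + 2 * (t * m) - enn ∧ 0 < lam1 S + 2 * (t * m) - enn := by
  constructor <;> linarith

/-! ## 3. Lemma 10 (c) for `λ₁`: freezing the level at `3tm`, the `R*` remainder -/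

/-- **Freezing the level**: if `M` and `M̄` have the Rayleigh forms of `B + b⊗b/D` and `B + b⊗b/D̄`,
then `|λ₁(M) − λ₁(M̄)| ≤ |b|² · |1/D − 1/D̄|` (`β² ≤ |b|²|w|²`). [folklore] -/
theorem abs_lam1_reduced_sub_le {M Mbar : Matrix (Fin 2) (Fin 2) ℝ} {D Dbar : ℝ}
    (hM : ∀ w : Fin 2 → ℝ, w ⬝ᵥ M *ᵥ w = B00 * w 0 ^ 2 + 2 * B01 * w 0 * w 1 + B11 * w 1 ^ 2 +
      (b0 * w 0 + b1 * w 1) ^ 2 / D)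
    (hMbar : ∀ w : Fin 2 → ℝ, w ⬝ᵥ Mbar *ᵥ w = B00 * w 0 ^ 2 + 2 * B01 * w 0 * w 1 + B11 * w 1 ^ 2 +
      (b0 * w 0 + b1 * w 1) ^ 2 / Dbar) :
    |lam1 M - lam1 Mbar| ≤ (b0 ^ 2 + b1 ^ 2) * |1 / D - 1 / Dbar| := by
  -- Cauchy–Schwarz in `ℝ²`: `β² ≤ |b|²|w|²`
  have hCS : ∀ w : Fin 2 → ℝ, (b0 * w 0 + b1 * w 1) ^ 2 ≤ (b0 ^ 2 + b1 ^ 2) * (w 0 ^ 2 + w 1 ^ 2) :=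
    fun w => by nlinarith [sq_nonneg (b0 * w 1 - b1 * w 0)]
  have hdiff : ∀ w : Fin 2 → ℝ, w ⬝ᵥ w = 1 →
      |w ⬝ᵥ M *ᵥ w - w ⬝ᵥ Mbar *ᵥ w| ≤ (b0 ^ 2 + b1 ^ 2) * |1 / D - 1 / Dbar| := by
    intro w hw
    simp only [dotProduct, Fin.sum_univ_two, ← pow_two] at hw
    rw [hM w, hMbar w]
    have : B00 * w 0 ^ 2 + 2 * B01 * w 0 * w 1 + B11 * w 1 ^ 2 + (b0 * w 0 + b1 * w 1) ^ 2 / D -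
        (B00 * w 0 ^ 2 + 2 * B01 * w 0 * w 1 + B11 * w 1 ^ 2 + (b0 * w 0 + b1 * w 1) ^ 2 / Dbar) =
        (b0 * w 0 + b1 * w 1) ^ 2 * (1 / D - 1 / Dbar) := by ring
    rw [this, abs_mul, abs_of_nonneg (sq_nonneg _)]
    have h1 := hCS w
    rw [hw, mul_one] at h1
    exact mul_le_mul_of_nonneg_right h1 (abs_nonneg _)
  rw [abs_sub_le_iff]
  constructor
  · -- `λ₁(M) ≤ λ₁(M̄) + c`
    have h := lam1_le (M := M) (c := lam1 Mbar + (b0 ^ 2 + b1 ^ 2) * |1 / D - 1 / Dbar|) fun w hw => by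
      have h1 := hdiff w hw
      have h2 := ray_le_lam1 Mbar hw
      rw [abs_le] at h1
      linarith [h1.2]
    linarith
  · have h := lam1_le (M := Mbar) (c := lam1 M + (b0 ^ 2 + b1 ^ 2) * |1 / D - 1 / Dbar|) fun w hw => by
      have h1 := hdiff w hw
      have h2 := ray_le_lam1 M hw
      rw [abs_le] at h1
      linarith [h1.1]
    linarith

/-- **The remainder**: if `3tm − 2ε ≤ D`, `|D − 3tm| ≤ 2ε` and `2ε < 3tm`, then
`|1/D − 1/(3tm)| ≤ 2ε/(3tm(3tm − 2ε))`. [folklore] -/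
theorem abs_inv_sub_inv_le {D ε : ℝ} (hε : 2 * ε < 3 * (t * m)) (hDlo : 3 * (t * m) - 2 * ε ≤ D)
    (hDabs : |D - 3 * (t * m)| ≤ 2 * ε) :
    |1 / D - 1 / (3 * (t * m))| ≤ 2 * ε / (3 * (t * m) * (3 * (t * m) - 2 * ε)) := by
  have hD : 0 < D := by linarith
  have h3 : 0 < 3 * (t * m) := by
    have : 0 ≤ 2 * ε := by linarith [abs_nonneg (D - 3 * (t * m)), hDabs]
    linarith
  have hgap : 0 < 3 * (t * m) - 2 * ε := by linarith
  rw [div_sub_div _ _ hD.ne' h3.ne', abs_div, abs_of_pos (mul_pos hD h3), one_mul, mul_one,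
    show |3 * (t * m) - D| = |D - 3 * (t * m)| from abs_sub_comm _ _]
  rw [div_le_div_iff₀ (mul_pos hD h3) (mul_pos h3 hgap)]
  have h1 : |D - 3 * (t * m)| * (3 * (t * m) * (3 * (t * m) - 2 * ε)) ≤
      2 * ε * (3 * (t * m) * (3 * (t * m) - 2 * ε)) :=
    mul_le_mul_of_nonneg_right hDabs (mul_pos h3 hgap).le
  have h2 : 2 * ε * (3 * (t * m) * (3 * (t * m) - 2 * ε)) ≤ 2 * ε * (D * (3 * (t * m))) := by
    have hε0 : 0 ≤ 2 * ε := by linarith [abs_nonneg (D - 3 * (t * m)), hDabs]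
    have h21 : 3 * (t * m) * (3 * (t * m) - 2 * ε) ≤ D * (3 * (t * m)) := by
      rw [mul_comm D]
      exact mul_le_mul_of_nonneg_left hDlo h3.le
    exact mul_le_mul_of_nonneg_left h21 hε0
  exact h1.trans h2

/-- **LEMMA 10 (c) FOR THE TOP EIGENVALUE (F1 PART I).** Let `S = tK + E` be given by its Rayleigh
form in the frame `(n^⊥, n)` with `tm > 0`, and assume the consequences of `|E| ≤ ε` that are used:
the `E`-form is `≤ ε|f|²`, `B₀₀ ≥ −ε`, `|e_nn| ≤ ε`, `|b|² ≤ ε²`, with `2ε < 3tm`. Let `M̄` have the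
Rayleigh form of the frozen reduced matrix `B + b⊗b/(3tm)`. Then
`|λ₁(S) − tm − λ₁(M̄)| ≤ ε² · 2ε/(3tm(3tm − 2ε)) = R*`: the top eigenvalue is `tm + β̄₁` up to
`R* = 2ε³/(3tm(3tm − 2ε))`, where `β̄₁` is the top eigenvalue of `B` CORRECTED BY THE RANK-ONE TILT
TERM `b⊗b/(3tm)`. [ours; F1 PART I Lemma 10 (c)] -/
theorem abs_lam1_sub_reduced_le
    (hS : ∀ f : Fin 3 → ℝ, f ⬝ᵥ S *ᵥ f = t * m * (f 0 ^ 2 + f 1 ^ 2 - 2 * f 2 ^ 2) +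
      (B00 * f 0 ^ 2 + 2 * B01 * f 0 * f 1 + B11 * f 1 ^ 2) + 2 * f 2 * (b0 * f 0 + b1 * f 1) + enn * f 2 ^ 2)
    (htm : 0 < t * m) {ε : ℝ} (hε : 2 * ε < 3 * (t * m))
    (hE : ∀ f : Fin 3 → ℝ, (B00 * f 0 ^ 2 + 2 * B01 * f 0 * f 1 + B11 * f 1 ^ 2) +
      2 * f 2 * (b0 * f 0 + b1 * f 1) + enn * f 2 ^ 2 ≤ ε * (f 0 ^ 2 + f 1 ^ 2 + f 2 ^ 2))
    (hB00 : -ε ≤ B00) (henn : |enn| ≤ ε) (hb : b0 ^ 2 + b1 ^ 2 ≤ ε ^ 2)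
    {Mbar : Matrix (Fin 2) (Fin 2) ℝ}
    (hMbar : ∀ w : Fin 2 → ℝ, w ⬝ᵥ Mbar *ᵥ w = B00 * w 0 ^ 2 + 2 * B01 * w 0 * w 1 + B11 * w 1 ^ 2 +
      (b0 * w 0 + b1 * w 1) ^ 2 / (3 * (t * m))) :
    |lam1 S - t * m - lam1 Mbar| ≤ ε ^ 2 * (2 * ε / (3 * (t * m) * (3 * (t * m) - 2 * ε))) := by
  obtain ⟨hlo, hhi⟩ := lam1_window hS htm.le hE hB00
  have henn' := (abs_le.1 henn)
  obtain ⟨hDlo, hD⟩ := reduced_level_pos hlo henn'.2 hε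
  set D := lam1 S + 2 * (t * m) - enn with hDdef
  -- the reduced matrix at the true level, realised as an explicit `2 × 2` matrix
  set M : Matrix (Fin 2) (Fin 2) ℝ := !![B00 + b0 * b0 / D, B01 + b0 * b1 / D;
    B01 + b0 * b1 / D, B11 + b1 * b1 / D] with hMdef
  have hM : ∀ w : Fin 2 → ℝ, w ⬝ᵥ M *ᵥ w = B00 * w 0 ^ 2 + 2 * B01 * w 0 * w 1 + B11 * w 1 ^ 2 +
      (b0 * w 0 + b1 * w 1) ^ 2 / D := by
    intro w
    simp [hMdef, Matrix.mulVec, dotProduct, Fin.sum_univ_two]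
    field_simp
    ring
  have hfix : lam1 M = lam1 S - t * m := lam1_reduced_eq hS hD hM
  have hfreeze := abs_lam1_reduced_sub_le (B00 := B00) (B01 := B01) (B11 := B11) (b0 := b0) (b1 := b1) hM hMbar
  have hDabs : |D - 3 * (t * m)| ≤ 2 * ε := by
    rw [abs_le]
    constructor <;> linarith [henn'.1, henn'.2]
  have hinv := abs_inv_sub_inv_le (t := t) (m := m) hε hDlo hDabs
  rw [← hfix]
  calc |lam1 M - lam1 Mbar| ≤ (b0 ^ 2 + b1 ^ 2) * |1 / D - 1 / (3 * (t * m))| := hfreeze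
    _ ≤ ε ^ 2 * (2 * ε / (3 * (t * m) * (3 * (t * m) - 2 * ε))) :=
        mul_le_mul hb hinv (abs_nonneg _) (by positivity)

end BlockReduction

end Summit.NavierStokesRegularity.FunctionalMining

end
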